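import Mathlib
import HarnessLib

/-!
# Route `PoloidalWindowDoor`, crux `PoloidalWindowRigidity` (stmt-NavierStokesRegularity-19708) — LINE 18 «leaf_uniform» /
# LINE 20 «hot_forest» (ns-idea-8, v1.3.1 / v1.1): the ANALYSIS CORE of R18 `HotRegularAlone` (Mathlib only)

Seat ns-es-p1 g7 (free prover hand; CLAIM announced on the ideators / ns-regularity-ideate buses before proposing).  No
Navier–Stokes content: the flow-box-free core of «near a REGULAR hot point the hot set is ONE vortex arc».  Mathlib has no
differentiable dependence of ODE flows on initial data, so the flow box is replaced by the first integral `ψ` (in the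
assembly: the tree's Clebsch potential, `ωₕ = (∂₁ψ, −∂₀ψ)`) and two one-variable strict-monotonicity arguments.

* `plane_decomp` — coordinates of plane points in the frame `T = (p,q,0)`, `N = (−q,p,0)`;
* `exists_strictMonoOn_of_deriv_pos_at_zero` — a `C¹` function with positive derivative at `0` is strictly increasing near `0`;
* `alone_core` — the statement described in its docstring.

HONEST LABEL: calculus lemmas; nothing about any crux, route item or Navier–Stokes regularity is proved here (all OPEN).
-/

noncomputable section

-- the summit and its single sub-problem share the name (CONVENTIONS §1), as in every Theorems file
set_option linter.dupNamespace false

namespace Summit.NavierStokesRegularity.NavierStokesRegularity.Theorems.PoloidalWindowDoorPoloidalWindowRigidityLeafUniformAloneCore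

open Set Function Filter Topology Metric

/-- Plane decomposition of `ℝ³`-points with equal third coordinate along the horizontal frame `T = (p,q,0)`, `N = (−q,p,0)`. [folklore] -/
theorem plane_decomp (p q : ℝ) (hm : p ^ 2 + q ^ 2 ≠ 0) (x y : EuclideanSpace ℝ (Fin 3))
    (hx : x 2 = 0) (hy : y 2 = 0) :
    x = y + (((x 0 - y 0) * p + (x 1 - y 1) * q) / (p ^ 2 + q ^ 2)) •
        (p • EuclideanSpace.single 0 (1 : ℝ) + q • EuclideanSpace.single 1 (1 : ℝ)) +
      ((-(x 0 - y 0) * q + (x 1 - y 1) * p) / (p ^ 2 + q ^ 2)) •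
        ((-q) • EuclideanSpace.single 0 (1 : ℝ) + p • EuclideanSpace.single 1 (1 : ℝ)) := by
  ext i
  fin_cases i
  · simp
    field_simp
    ring
  · simp
    field_simp
    ring
  · simp [hx, hy]

/-- If `f : ℝ → ℝ` has derivative `f' s` at every `s`, `f'` is continuous and `f' 0 > 0`, then `f` is strictly monotone on
some `[−κ, κ]`, `κ > 0`. [folklore] -/
theorem exists_strictMonoOn_of_deriv_pos_at_zero {f f' : ℝ → ℝ} (hf : ∀ s, HasDerivAt f (f' s) s)
    (hc : Continuous f') (h0 : 0 < f' 0) : ∃ κ > 0, StrictMonoOn f (Icc (-κ) κ) := by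
  obtain ⟨κ, hκ, hpos⟩ : ∃ κ > 0, ∀ s, dist s 0 < κ → 0 < f' s := by
    have h := (hc.continuousAt (x := 0)).eventually (lt_mem_nhds h0)
    obtain ⟨κ, hκ, h'⟩ := Metric.eventually_nhds_iff.1 h
    exact ⟨κ, hκ, fun s hs => h' hs⟩
  refine ⟨κ / 2, by positivity, ?_⟩
  refine strictMonoOn_of_deriv_pos (convex_Icc _ _)
    (fun s _ => (hf s).continuousAt.continuousWithinAt) fun s hs => ?_
  rw [interior_Icc] at hs
  rw [(hf s).deriv]
  apply hpos
  rw [Real.dist_eq, sub_zero, abs_lt]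
  constructor <;> linarith [hs.1, hs.2]

/-- **Core of R18 (flow-box-free).**  `w, ψ : ℝ³ → ℝ`, `ω : ℝ³ → ℝ³` continuous with `∇ₕψ = Jωₕ` (`∂₀ψ = −ω₁`,
`∂₁ψ = ω₀`) and `ω₂ ≡ 0`; `y` a plane point (`y₂ = 0`) with `ω(y) ≠ 0`; near `y`, on the plane, `w = G ∘ ψ` (structure function);
`w` analytic; the level set `{w = w y}` has empty interior in the plane near `y`; `α` a global integral curve of `ω` through `y`.
THEN plane points `x` near `y` with `w x = w y` lie on `α` near parameter `0`.  Proof: `σ ↦ w(y + σN)` (`N = ∇ₕψ(y)`) is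
analytic and not locally constant (else, by strict monotonicity of `σ ↦ ψ(y+σN)`, IVT and continuity of `ψ`, a plane
neighbourhood of `y` would be in the level set), so `σ = 0` is isolated in `{σ | w(y+σN) = w y}`
(`AnalyticAt.eventually_eq_or_eventually_ne`); hence `ψ x = ψ y` for such `x`; `ψ` and `x₂` are first integrals along `α`, the
tangential frame coordinate of `α` is strictly increasing near `0` (IVT matches it with that of `x`), and the normal coordinate is
forced by strict monotonicity of `b ↦ ψ(y + aT + bN)` (`∂_Nψ > 0` on a square). [folklore] -/
theorem alone_core {w ψ : EuclideanSpace ℝ (Fin 3) → ℝ}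
    {ω : EuclideanSpace ℝ (Fin 3) → EuclideanSpace ℝ (Fin 3)} {y : EuclideanSpace ℝ (Fin 3)}
    {α : ℝ → EuclideanSpace ℝ (Fin 3)}
    (hwan : ∀ x, AnalyticAt ℝ w x) (hψ : ContDiff ℝ 1 ψ) (hωc : Continuous ω)
    (hgrad : ∀ x, fderiv ℝ ψ x (EuclideanSpace.single 0 1) = -(ω x 1) ∧
      fderiv ℝ ψ x (EuclideanSpace.single 1 1) = ω x 0)
    (hω2 : ∀ x, ω x 2 = 0) (hy2 : y 2 = 0) (hωy : ω y ≠ 0)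
    (hstruct : ∃ ρ > 0, ∃ G : ℝ → ℝ, ∀ x : EuclideanSpace ℝ (Fin 3), x 2 = 0 → dist x y < ρ → w x = G (ψ x))
    (hNoInt : ∀ r > 0, ∃ x : EuclideanSpace ℝ (Fin 3), x 2 = 0 ∧ dist x y < r ∧ w x ≠ w y)
    (hα0 : α 0 = y) (hα : ∀ s, HasDerivAt α (ω (α s)) s) :
    ∃ r > 0, ∃ δ > 0, ∀ x : EuclideanSpace ℝ (Fin 3), x 2 = 0 → w x = w y → dist x y < r →
      ∃ s ∈ Ioo (-δ) δ, x = α s := by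
  -- the frame at `y`
  set p : ℝ := ω y 0 with hp
  set q : ℝ := ω y 1 with hq
  have hm : 0 < p ^ 2 + q ^ 2 := by
    rcases (ne_or_eq p 0) with h | h
    · have := sq_pos_of_ne_zero h; positivity
    · have hq0 : q ≠ 0 := by
        intro hq0; apply hωy; ext i; fin_cases i <;> simp [← hp, ← hq, h, hq0, hω2 y]
      have := sq_pos_of_ne_zero hq0; positivity
  set m : ℝ := p ^ 2 + q ^ 2 with hmdef
  have hm0 : m ≠ 0 := hm.ne'
  -- the frame vectors and a length bound
  set T : EuclideanSpace ℝ (Fin 3) := p • EuclideanSpace.single 0 (1 : ℝ) + q • EuclideanSpace.single 1 (1 : ℝ) with hT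
  set Nn : EuclideanSpace ℝ (Fin 3) := (-q) • EuclideanSpace.single 0 (1 : ℝ) + p • EuclideanSpace.single 1 (1 : ℝ)
    with hNn
  set Lc : ℝ := |p| + |q| + 1 with hLc
  have hLc0 : 0 < Lc := by positivity
  have hT2n : ‖T‖ ^ 2 = p ^ 2 + q ^ 2 := by
    rw [EuclideanSpace.real_norm_sq_eq, Fin.sum_univ_three]
    simp [hT]
  have hNn2n : ‖Nn‖ ^ 2 = p ^ 2 + q ^ 2 := by
    rw [EuclideanSpace.real_norm_sq_eq, Fin.sum_univ_three]
    simp [hNn]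
    ring
  have hTn : ‖T‖ ≤ Lc := by
    have h := abs_le_of_sq_le_sq (a := ‖T‖) (b := |p| + |q|)
      (by rw [hT2n, add_sq, sq_abs, sq_abs]; have := mul_nonneg (abs_nonneg p) (abs_nonneg q); linarith)
      (by positivity)
    rw [abs_norm] at h
    rw [hLc]; linarith
  have hNnn : ‖Nn‖ ≤ Lc := by
    have h := abs_le_of_sq_le_sq (a := ‖Nn‖) (b := |p| + |q|)
      (by rw [hNn2n, add_sq, sq_abs, sq_abs]; have := mul_nonneg (abs_nonneg p) (abs_nonneg q); linarith)
      (by positivity)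
    rw [abs_norm] at h
    rw [hLc]; linarith
  have hNn2 : Nn 2 = 0 := by simp [hNn]
  have hT2 : T 2 = 0 := by simp [hT]
  have hplane : ∀ a b : ℝ, (y + a • T + b • Nn) 2 = 0 := by
    intro a b
    simp [hT, hNn, hy2]
  have hdist_ab : ∀ a b : ℝ, dist (y + a • T + b • Nn) y ≤ (|a| + |b|) * Lc := by
    intro a b
    rw [dist_eq_norm, show y + a • T + b • Nn - y = a • T + b • Nn by abel]
    refine (norm_add_le _ _).trans ?_
    rw [norm_smul, norm_smul, Real.norm_eq_abs, Real.norm_eq_abs]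
    have h1 := mul_le_mul_of_nonneg_left hTn (abs_nonneg a)
    have h2 := mul_le_mul_of_nonneg_left hNnn (abs_nonneg b)
    linarith
  -- coordinates of plane points relative to the frame
  have hdecomp : ∀ x : EuclideanSpace ℝ (Fin 3), x 2 = 0 →
      x = y + (((x 0 - y 0) * p + (x 1 - y 1) * q) / m) • T + ((-(x 0 - y 0) * q + (x 1 - y 1) * p) / m) • Nn :=
    fun x hx => plane_decomp p q hm0 x y hx hy2
  -- continuity of coordinates and of `ω`'s components
  have hωi : ∀ i : Fin 3, Continuous fun x => ω x i := fun i =>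
    (EuclideanSpace.proj i : EuclideanSpace ℝ (Fin 3) →L[ℝ] ℝ).continuous.comp hωc
  have hxi : ∀ i : Fin 3, Continuous fun x : EuclideanSpace ℝ (Fin 3) => x i := fun i =>
    (EuclideanSpace.proj i : EuclideanSpace ℝ (Fin 3) →L[ℝ] ℝ).continuous
  have ha_cont : Continuous fun x : EuclideanSpace ℝ (Fin 3) => ((x 0 - y 0) * p + (x 1 - y 1) * q) / m :=
    ((((hxi 0).sub continuous_const).mul continuous_const).add
      (((hxi 1).sub continuous_const).mul continuous_const)).div_const m
  have hb_cont : Continuous fun x : EuclideanSpace ℝ (Fin 3) => (-(x 0 - y 0) * q + (x 1 - y 1) * p) / m :=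
    ((((hxi 0).sub continuous_const).neg.mul continuous_const).add
      (((hxi 1).sub continuous_const).mul continuous_const)).div_const m
  -- the normal derivative of `ψ`
  have hψd : ∀ x, DifferentiableAt ℝ ψ x := fun x => (hψ.differentiable one_ne_zero) x
  have hD : ∀ x, fderiv ℝ ψ x Nn = q * ω x 1 + p * ω x 0 := by
    intro x
    simp only [hNn, map_add, map_smul, smul_eq_mul, (hgrad x).1, (hgrad x).2]
    ring
  have hDcont : Continuous fun x => q * ω x 1 + p * ω x 0 :=
    (continuous_const.mul (hωi 1)).add (continuous_const.mul (hωi 0))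
  have hDy : q * ω y 1 + p * ω y 0 = m := by rw [hmdef, hp, hq]; ring
  obtain ⟨κ, hκ, hκpos⟩ : ∃ κ > 0, ∀ x, dist x y < κ → 0 < q * ω x 1 + p * ω x 0 := by
    have h := (hDcont.continuousAt (x := y)).eventually (lt_mem_nhds (show (0 : ℝ) < q * ω y 1 + p * ω y 0 by
      rw [hDy]; exact hm))
    obtain ⟨κ, hκ, h'⟩ := Metric.eventually_nhds_iff.1 h
    exact ⟨κ, hκ, fun x hx => h' hx⟩
  -- the square `|a|, |b| < κ₁` on which `∂_N ψ > 0`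
  set κ₁ : ℝ := κ / (2 * Lc) with hκ₁
  have hκ₁0 : 0 < κ₁ := by positivity
  have hsq : ∀ a b : ℝ, |a| < κ₁ → |b| < κ₁ → dist (y + a • T + b • Nn) y < κ := by
    intro a b ha hb
    refine (hdist_ab a b).trans_lt ?_
    have : (|a| + |b|) * Lc < (κ₁ + κ₁) * Lc := mul_lt_mul_of_pos_right (add_lt_add ha hb) hLc0
    have h2 : (κ₁ + κ₁) * Lc = κ := by rw [hκ₁]; field_simp; ring
    linarith
  -- `b ↦ ψ (y + aT + bN)` has derivative `∂_N ψ` and is strictly increasing on the square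
  have hQ : ∀ a b : ℝ, HasDerivAt (fun b : ℝ => ψ (y + a • T + b • Nn))
      (fderiv ℝ ψ (y + a • T + b • Nn) Nn) b := by
    intro a b
    have hg : HasDerivAt (fun b : ℝ => y + a • T + b • Nn) Nn b := by
      have h := ((hasDerivAt_id b).smul_const Nn).const_add (y + a • T)
      simp only [id, one_smul] at h
      exact h
    exact (hψd _).hasFDerivAt.comp_hasDerivAt b hg
  have hmonoQ : ∀ a : ℝ, |a| < κ₁ → StrictMonoOn (fun b : ℝ => ψ (y + a • T + b • Nn)) (Ioo (-κ₁) κ₁) := by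
    intro a ha
    refine strictMonoOn_of_deriv_pos (convex_Ioo _ _)
      (fun b _ => (hQ a b).continuousAt.continuousWithinAt) fun b hb => ?_
    rw [interior_Ioo] at hb
    rw [(hQ a b).deriv, hD]
    exact hκpos _ (hsq a b ha (abs_lt.2 ⟨hb.1, hb.2⟩))
  have hinjQ : ∀ a : ℝ, |a| < κ₁ → ∀ b₁ b₂ : ℝ, |b₁| < κ₁ → |b₂| < κ₁ →
      ψ (y + a • T + b₁ • Nn) = ψ (y + a • T + b₂ • Nn) → b₁ = b₂ := by
    intro a ha b₁ b₂ hb₁ hb₂ heq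
    exact (hmonoQ a ha).injOn (abs_lt.1 hb₁ |> fun h => ⟨h.1, h.2⟩) (abs_lt.1 hb₂ |> fun h => ⟨h.1, h.2⟩) heq
  -- the transversal `σ ↦ y + σN` (the case `a = 0`)
  have h0T : ∀ σ : ℝ, y + (0 : ℝ) • T + σ • Nn = y + σ • Nn := fun σ => by rw [zero_smul, add_zero]
  have hmono0 : StrictMonoOn (fun σ : ℝ => ψ (y + σ • Nn)) (Ioo (-κ₁) κ₁) := by
    have h := hmonoQ 0 (by rw [abs_zero]; exact hκ₁0)
    simp only [zero_smul, add_zero] at h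
    exact h
  have hcont0 : Continuous fun σ : ℝ => ψ (y + σ • Nn) :=
    hψ.continuous.comp (continuous_const.add (continuous_id.smul continuous_const))
  -- analyticity of `Φ(σ) = w(y + σN)` and the dichotomy
  have hΦ : AnalyticAt ℝ (fun σ : ℝ => w (y + σ • Nn)) 0 := by
    have haff : AnalyticAt ℝ (fun σ : ℝ => y + σ • Nn) 0 :=
      analyticAt_const.add ((analyticAt_id).smul analyticAt_const)
    exact (hwan _).comp haff
  obtain ⟨ρ, hρ, G, hG⟩ := hstruct
  -- a common device: from a radius `σ₀` build the transversal window and the `ψ`-window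
  have hwindow : ∀ σ₀ : ℝ, 0 < σ₀ → ∃ θ : ℝ, 0 < θ ∧ θ < σ₀ ∧ θ < κ₁ ∧ θ * Lc < ρ ∧
      ψ (y + (-θ) • Nn) < ψ y ∧ ψ y < ψ (y + θ • Nn) ∧
      (∀ c ∈ Ioo (ψ (y + (-θ) • Nn)) (ψ (y + θ • Nn)), ∃ σ ∈ Ioo (-θ) θ, ψ (y + σ • Nn) = c) ∧
      ∃ r₁ : ℝ, 0 < r₁ ∧ ∀ x, dist x y < r₁ → ψ x ∈ Ioo (ψ (y + (-θ) • Nn)) (ψ (y + θ • Nn)) := by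
    intro σ₀ hσ₀
    set θ : ℝ := min σ₀ (min κ₁ (ρ / Lc)) / 2 with hθ
    have hθ0 : 0 < θ := by positivity
    have hθσ : θ < σ₀ := by
      have : min σ₀ (min κ₁ (ρ / Lc)) ≤ σ₀ := min_le_left _ _
      rw [hθ]; linarith
    have hθκ : θ < κ₁ := by
      have : min σ₀ (min κ₁ (ρ / Lc)) ≤ κ₁ := (min_le_right _ _).trans (min_le_left _ _)
      rw [hθ]; linarith
    have hθρ : θ * Lc < ρ := by
      have h1 : min σ₀ (min κ₁ (ρ / Lc)) ≤ ρ / Lc := (min_le_right _ _).trans (min_le_right _ _)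
      have h2 : θ < ρ / Lc := by rw [hθ]; linarith [div_pos hρ hLc0]
      calc θ * Lc < ρ / Lc * Lc := mul_lt_mul_of_pos_right h2 hLc0
        _ = ρ := by field_simp
    have hy0 : ψ (y + (0 : ℝ) • Nn) = ψ y := by rw [zero_smul, add_zero]
    have hlo : ψ (y + (-θ) • Nn) < ψ y := by
      rw [← hy0]
      exact hmono0 ⟨by linarith, by linarith⟩ ⟨by linarith, by linarith⟩ (by linarith)
    have hhi : ψ y < ψ (y + θ • Nn) := by
      rw [← hy0]
      exact hmono0 ⟨by linarith, by linarith⟩ ⟨by linarith, by linarith⟩ (by linarith)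
    have hivt : ∀ c ∈ Ioo (ψ (y + (-θ) • Nn)) (ψ (y + θ • Nn)), ∃ σ ∈ Ioo (-θ) θ, ψ (y + σ • Nn) = c := by
      intro c hc
      have h := intermediate_value_Ioo (show -θ ≤ θ by linarith) hcont0.continuousOn hc
      obtain ⟨σ, hσ, hσc⟩ := h
      exact ⟨σ, hσ, hσc⟩
    obtain ⟨r₁, hr₁, hr₁'⟩ : ∃ r₁ > 0, ∀ x, dist x y < r₁ →
        ψ x ∈ Ioo (ψ (y + (-θ) • Nn)) (ψ (y + θ • Nn)) := by
      have h := (hψ.continuous.continuousAt (x := y)).eventually (Ioo_mem_nhds hlo hhi)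
      obtain ⟨r₁, hr₁, h'⟩ := Metric.eventually_nhds_iff.1 h
      exact ⟨r₁, hr₁, fun x hx => h' hx⟩
    exact ⟨θ, hθ0, hθσ, hθκ, hθρ, hlo, hhi, hivt, r₁, hr₁, hr₁'⟩
  -- points of the transversal are plane points within `ρ` when `|σ| ≤ θ`, `θ Lc < ρ`
  have htrans : ∀ θ σ : ℝ, θ * Lc < ρ → |σ| ≤ θ → dist (y + σ • Nn) y < ρ := by
    intro θ σ hθρ hσ
    have h := hdist_ab 0 σ
    rw [zero_smul, add_zero, abs_zero, zero_add] at h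
    calc dist (y + σ • Nn) y ≤ |σ| * Lc := h
      _ ≤ θ * Lc := mul_le_mul_of_nonneg_right hσ hLc0.le
      _ < ρ := hθρ
  have hplane0 : ∀ σ : ℝ, (y + σ • Nn) 2 = 0 := fun σ => by simp [hNn, hy2]
  -- the dichotomy: `Φ` is not locally constant (no-interior hypothesis), hence `0` is isolated in `{Φ = w y}`
  have hiso : ∀ᶠ σ in 𝓝[≠] (0 : ℝ), w (y + σ • Nn) ≠ w y := by
    rcases hΦ.eventually_eq_or_eventually_ne analyticAt_const with hev | hne'
    · exfalso
      obtain ⟨σ₂, hσ₂, hev'⟩ : ∃ σ₂ > 0, ∀ σ : ℝ, |σ| < σ₂ → w (y + σ • Nn) = w y := by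
        obtain ⟨σ₂, hσ₂, h'⟩ := Metric.eventually_nhds_iff.1 hev
        exact ⟨σ₂, hσ₂, fun σ hσ => h' (by rwa [Real.dist_eq, sub_zero])⟩
      obtain ⟨θ, hθ0, hθσ, hθκ, hθρ, hlo, hhi, hivt, r₁, hr₁, hr₁'⟩ := hwindow σ₂ hσ₂
      have hGc : ∀ c ∈ Ioo (ψ (y + (-θ) • Nn)) (ψ (y + θ • Nn)), G c = w y := by
        intro c hc
        obtain ⟨σ, hσ, hσc⟩ := hivt c hc
        have hσθ : |σ| ≤ θ := abs_le.2 ⟨hσ.1.le, hσ.2.le⟩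
        rw [← hσc, ← hG _ (hplane0 σ) (htrans θ σ hθρ hσθ)]
        exact hev' σ (lt_of_le_of_lt hσθ hθσ)
      obtain ⟨x, hx2, hxd, hxw⟩ := hNoInt (min r₁ ρ) (lt_min hr₁ hρ)
      apply hxw
      rw [hG x hx2 (hxd.trans_le (min_le_right _ _))]
      exact hGc _ (hr₁' x (hxd.trans_le (min_le_left _ _)))
    · exact hne'
  obtain ⟨σ₀, hσ₀, hσ₀'⟩ : ∃ σ₀ > 0, ∀ σ : ℝ, σ ≠ 0 → |σ| < σ₀ → w (y + σ • Nn) ≠ w y := by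
    rw [eventually_nhdsWithin_iff] at hiso
    obtain ⟨σ₀, hσ₀, h'⟩ := Metric.eventually_nhds_iff.1 hiso
    exact ⟨σ₀, hσ₀, fun σ hne hσ => h' (by rwa [Real.dist_eq, sub_zero]) hne⟩
  obtain ⟨θ, hθ0, hθσ, hθκ, hθρ, hlo, hhi, hivt, r₁, hr₁, hr₁'⟩ := hwindow σ₀ hσ₀
  -- KEY 1: a hot plane point near `y` lies on the `ψ`-level set of `y`
  have hkey1 : ∀ x : EuclideanSpace ℝ (Fin 3), x 2 = 0 → dist x y < min r₁ ρ → w x = w y → ψ x = ψ y := by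
    intro x hx2 hxd hxw
    obtain ⟨σ, hσ, hσc⟩ := hivt (ψ x) (hr₁' x (hxd.trans_le (min_le_left _ _)))
    have hσθ : |σ| ≤ θ := abs_le.2 ⟨hσ.1.le, hσ.2.le⟩
    by_cases hσ0 : σ = 0
    · rw [← hσc, hσ0, zero_smul, add_zero]
    · exfalso
      apply hσ₀' σ hσ0 (lt_of_le_of_lt hσθ hθσ)
      rw [hG _ (hplane0 σ) (htrans θ σ hθρ hσθ), hσc, ← hG x hx2 (hxd.trans_le (min_le_right _ _)), hxw]
  -- the vortex line through `y`: first integrals and frame coordinates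
  have hαc : Continuous α := continuous_iff_continuousAt.2 fun s => (hα s).continuousAt
  have hαi : ∀ (i : Fin 3) (s : ℝ), HasDerivAt (fun s => α s i) (ω (α s) i) s := fun i s =>
    ((EuclideanSpace.proj i : EuclideanSpace ℝ (Fin 3) →L[ℝ] ℝ).hasFDerivAt.comp_hasDerivAt s (hα s))
  have hα2 : ∀ s, α s 2 = 0 := by
    intro s
    have hd : ∀ s, HasDerivAt (fun s => α s 2) 0 s := fun s => by
      have h := hαi 2 s; rwa [hω2] at h
    have hc : α s 2 = α 0 2 :=
      is_const_of_deriv_eq_zero (f := fun s => α s 2) (fun s => (hd s).differentiableAt) (fun s => (hd s).deriv) s 0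
    rw [hc, hα0]; exact hy2
  have hψα : ∀ s, ψ (α s) = ψ y := by
    have hd : ∀ s, HasDerivAt (fun s => ψ (α s)) 0 s := fun s => by
      have h := (hψd (α s)).hasFDerivAt.comp_hasDerivAt s (hα s)
      have hz : fderiv ℝ ψ (α s) (ω (α s)) = 0 := by
        have hdec : ω (α s) = ω (α s) 0 • EuclideanSpace.single 0 (1 : ℝ) + ω (α s) 1 • EuclideanSpace.single 1 (1 : ℝ) +
            ω (α s) 2 • EuclideanSpace.single 2 (1 : ℝ) := by
          ext i; fin_cases i <;> simp
        have hg1 := (hgrad (α s)).1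
        have hg2 := (hgrad (α s)).2
        rw [hdec]
        simp only [map_add, map_smul, smul_eq_mul, hg1, hg2, hω2 (α s)]
        ring
      rw [hz] at h
      exact h
    intro s
    have hc : ψ (α s) = ψ (α 0) :=
      is_const_of_deriv_eq_zero (f := fun s => ψ (α s)) (fun s => (hd s).differentiableAt) (fun s => (hd s).deriv) s 0
    rw [hc, hα0]
  -- tangential coordinate along `α`: strictly increasing near `0`
  have hA : ∀ s, HasDerivAt (fun s => ((α s 0 - y 0) * p + (α s 1 - y 1) * q) / m)
      ((ω (α s) 0 * p + ω (α s) 1 * q) / m) s := by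
    intro s
    have h := (((hαi 0 s).sub_const (y 0)).mul_const p).add (((hαi 1 s).sub_const (y 1)).mul_const q)
    exact h.div_const m
  have hA'c : Continuous fun s => (ω (α s) 0 * p + ω (α s) 1 * q) / m := by
    have h0 := (hωi 0).comp hαc; have h1 := (hωi 1).comp hαc
    exact ((h0.mul continuous_const).add (h1.mul continuous_const)).div_const m
  have hA'0 : 0 < (ω (α 0) 0 * p + ω (α 0) 1 * q) / m := by
    rw [hα0, ← hp, ← hq]
    have : (p * p + q * q) / m = 1 := by rw [div_eq_one_iff_eq hm0, hmdef]; ring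
    linarith
  obtain ⟨s₁, hs₁, hmonoA⟩ := exists_strictMonoOn_of_deriv_pos_at_zero hA hA'c hA'0
  -- normal coordinate along `α`: small near `0`
  have hBc : Continuous fun s => (-(α s 0 - y 0) * q + (α s 1 - y 1) * p) / m := hb_cont.comp hαc
  obtain ⟨s₃, hs₃, hs₃'⟩ : ∃ s₃ > 0, ∀ s : ℝ, |s| < s₃ →
      |(-(α s 0 - y 0) * q + (α s 1 - y 1) * p) / m| < κ₁ := by
    have h := Metric.continuousAt_iff.1 (hBc.continuousAt (x := 0)) κ₁ hκ₁0
    obtain ⟨s₃, hs₃, h'⟩ := h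
    refine ⟨s₃, hs₃, fun s hs => ?_⟩
    have h'' := h' (x := s) (by rwa [Real.dist_eq, sub_zero])
    rw [hα0, Real.dist_eq] at h''
    simpa using h''
  set s₂ : ℝ := min s₁ s₃ / 2 with hs₂
  have hs₂0 : 0 < s₂ := by positivity
  have hs₂1 : s₂ < s₁ := by have := min_le_left s₁ s₃; rw [hs₂]; linarith
  have hs₂3 : s₂ < s₃ := by have := min_le_right s₁ s₃; rw [hs₂]; linarith
  have hA0 : ((α 0 0 - y 0) * p + (α 0 1 - y 1) * q) / m = 0 := by rw [hα0]; simp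
  have hAlo : ((α (-s₂) 0 - y 0) * p + (α (-s₂) 1 - y 1) * q) / m < 0 := by
    rw [← hA0]
    exact hmonoA ⟨by linarith, by linarith⟩ ⟨by linarith, by linarith⟩ (by linarith)
  have hAhi : 0 < ((α s₂ 0 - y 0) * p + (α s₂ 1 - y 1) * q) / m := by
    rw [← hA0]
    exact hmonoA ⟨by linarith, by linarith⟩ ⟨by linarith, by linarith⟩ (by linarith)
  -- radius on which the frame coordinates of `x` are small / in the range of `A`
  obtain ⟨r₂, hr₂, hr₂'⟩ : ∃ r₂ > 0, ∀ x : EuclideanSpace ℝ (Fin 3), dist x y < r₂ →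
      |((x 0 - y 0) * p + (x 1 - y 1) * q) / m| < κ₁ ∧
      ((x 0 - y 0) * p + (x 1 - y 1) * q) / m ∈
        Ioo (((α (-s₂) 0 - y 0) * p + (α (-s₂) 1 - y 1) * q) / m) (((α s₂ 0 - y 0) * p + (α s₂ 1 - y 1) * q) / m) ∧
      |(-(x 0 - y 0) * q + (x 1 - y 1) * p) / m| < κ₁ := by
    set ε : ℝ := min κ₁ (min (-(((α (-s₂) 0 - y 0) * p + (α (-s₂) 1 - y 1) * q) / m))
      (((α s₂ 0 - y 0) * p + (α s₂ 1 - y 1) * q) / m)) with hε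
    have hε0 : 0 < ε := lt_min hκ₁0 (lt_min (by linarith) hAhi)
    obtain ⟨ra, hra, hra'⟩ := Metric.continuousAt_iff.1 (ha_cont.continuousAt (x := y)) ε hε0
    obtain ⟨rb, hrb, hrb'⟩ := Metric.continuousAt_iff.1 (hb_cont.continuousAt (x := y)) ε hε0
    refine ⟨min ra rb, lt_min hra hrb, fun x hx => ?_⟩
    have ha := hra' (x := x) (hx.trans_le (min_le_left _ _))
    have hb := hrb' (x := x) (hx.trans_le (min_le_right _ _))
    simp only [sub_self, zero_mul, neg_zero, add_zero, zero_div, Real.dist_eq, sub_zero] at ha hb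
    have hε1 : ε ≤ κ₁ := min_le_left _ _
    have hε2 : ε ≤ -(((α (-s₂) 0 - y 0) * p + (α (-s₂) 1 - y 1) * q) / m) :=
      (min_le_right _ _).trans (min_le_left _ _)
    have hε3 : ε ≤ ((α s₂ 0 - y 0) * p + (α s₂ 1 - y 1) * q) / m := (min_le_right _ _).trans (min_le_right _ _)
    refine ⟨lt_of_lt_of_le ha hε1, ⟨?_, ?_⟩, lt_of_lt_of_le hb hε1⟩
    · have := (abs_lt.1 ha).1; linarith
    · have := (abs_lt.1 ha).2; linarith
  -- conclusion
  refine ⟨min (min r₁ ρ) r₂, lt_min (lt_min hr₁ hρ) hr₂, s₂, hs₂0, fun x hx2 hxw hxd => ?_⟩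
  have hψx : ψ x = ψ y := hkey1 x hx2 (hxd.trans_le (min_le_left _ _)) hxw
  obtain ⟨hax, haIoo, hbx⟩ := hr₂' x (hxd.trans_le (min_le_right _ _))
  -- match the tangential coordinate along `α` (IVT)
  have hAcont : ContinuousOn (fun s => ((α s 0 - y 0) * p + (α s 1 - y 1) * q) / m) (Icc (-s₂) s₂) :=
    fun s _ => (hA s).continuousAt.continuousWithinAt
  obtain ⟨s, hs, hsA⟩ := intermediate_value_Ioo (show -s₂ ≤ s₂ by linarith) hAcont haIoo
  beta_reduce at hsA
  have hsabs : |s| < s₃ := abs_lt.2 ⟨by linarith [hs.1], by linarith [hs.2]⟩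
  have hBs := hs₃' s hsabs
  -- the normal coordinates agree (strict monotonicity in `b`)
  have hxdec := hdecomp x hx2
  have hαdec := hdecomp (α s) (hα2 s)
  have hQx : ψ (y + (((x 0 - y 0) * p + (x 1 - y 1) * q) / m) • T +
      ((-(x 0 - y 0) * q + (x 1 - y 1) * p) / m) • Nn) = ψ y := by rw [← hxdec]; exact hψx
  have hQα : ψ (y + (((x 0 - y 0) * p + (x 1 - y 1) * q) / m) • T +
      ((-(α s 0 - y 0) * q + (α s 1 - y 1) * p) / m) • Nn) = ψ y := by
    rw [← hsA, ← hαdec]; exact hψα s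
  have hbeq := hinjQ _ hax _ _ hbx hBs (hQx.trans hQα.symm)
  refine ⟨s, hs, ?_⟩
  rw [hxdec, hαdec, hsA, hbeq]

end Summit.NavierStokesRegularity.NavierStokesRegularity.Theorems.PoloidalWindowDoorPoloidalWindowRigidityLeafUniformAloneCore

end
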